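import Literature.NumberTheory.Rogawski1990.ArchBouazizClassMap        -- ★ p851469 (LH10-p01 (g5)): `bzClassMap`, `continuous_bzClassMap`; brings ★ `RegS ∕ InRegS`, `archRH`, the moves
import Literature.Analysis.Calculus.SmoothCutoffLocalization           -- ★ p851476 (F0P3a-p06 (g20)): `exists_fin_contDiff_tsupport_subset_ball_sum_eq_one` (smooth finite partitions of unity)
import HarnessLib

/-!
# (Σ4c) DESCENT THROUGH THE STABLE-CLASS MAP AT A REGULAR CHART POINT — the ASSEMBLY: a smooth local section of the class map + the fibre identity «same class ⇒ same
# `Ψ∕Φ`» ⇒ `∃ F ∈ C^∞(class space), F(bzClassMap S c) · Φ c = Ψ c` near the base class (L3′ SURJ road, organ (Σ-REG); Bouaziz 1994 §5.1, Varadarajan 1989 §6 p. 229)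

Topic `NumberTheory/Rogawski1990`; namespace `Literature.NumberTheory.Rogawski1990`.  THEOREMS ONLY (no `def`, no instance, no axiom, no `sorry`).  Cell `pub/hodgecm-mathlib`,
crux H413 (`stmt-HodgeConjecture-24833`), line LH3 (closer stub `stub_N9`), letter L3′, SURJ-OF-FORWARD road (RULINGS #22∕#23; binder LH10-p01 (g5)), organ (Σ-REG) (interface
binder F0P3a-p04 (g25)), brick **(Σ4c-asm)** of the carve 12:57:32Z ((Σ4c-sec) LH3-p04 (g4), (Σ4c-desc) LH3-p03 (g6), (Σ4c-asm) this seat).  Author LH10-p02 (g7).  Count-neutral.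

WHAT.  p04's (Σ4c) interface (12:51:49Z (2)) **`exists_classDescent`** — near a regular chart point `c₀` of the chart `S`, for a fixed (P)(W)(X)-covariant «denominator» `Φ` smooth on
`InRegS S` and non-zero on the `ε₀`-class-neighbourhood of `c₀`, there is ONE `ε ∈ (0, ε₀]` such that EVERY (P)(W)(X)-covariant `Ψ` smooth on `InRegS S` descends: `F ∈ C^∞` on the
class space `W → ℂ × ℂ × ℂ` with `F (bzClassMap S c) · Φ c = Ψ c` for `c ∈ RegS S` with class `ε`-close to that of `c₀` — is proved here MODULO its two carved inputs taken as
hypotheses (`exists_classDescent_of_section_of_descent`): (sec) a `C^∞` local SECTION `σ` of `bzClassMap S` at `bzClassMap S c₀` (`σ(b₀) = c₀`,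
`bzClassMap S (σ (bzClassMap S c)) = bzClassMap S c` on an open `U ∋ b₀`; LH3-p04's `exists_contDiffOn_section_bzClassMap`) and (desc) the FIBRE IDENTITY «same class in `RegS S` ⇒
`Φ c′ ≠ 0 ∧ Ψ c ∕ Φ c = Ψ c′ ∕ Φ c′`» (LH3-p03's `div_eq_div_of_bzClassMap_eq`; the plain-invariance case is ★ `apply_eq_of_bzClassMap_eq`).  Construction: shrink `U` so that `σ` lands in
`RegS S` and `bzClassMap S ∘ σ` in the `ε₀`-ball (continuity), take a smooth cutoff `χ ≡ 1` on the closed `ε`-ball with `tsupport χ ⊆ ball b₀ (2ε) ⊆ U` (★ p851476 on the compact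
closed ball, constant radii — §1 `exists_contDiff_eq_one_closedBall_tsupport_subset`), and `F := χ · ((Ψ ∘ σ) · (Φ ∘ σ)⁻¹)`, smooth everywhere by §1 `contDiff_ofReal_mul_of_tsupport_subset`
(a product with a smooth cutoff is `C^∞` once the other factor is `C^∞` on an open set containing the cutoff's topological support).  The partition step «il suffit de prouver le
théorème dans un bon voisinage de chaque élément semi-simple» (Bouaziz §5.1) and Varadarajan's regular germs (p. 229) use exactly this descent to class functions.
HONEST LABEL: L3′ stays XL∕PRINT-labelled ((Σ-WALL) PRINT, RULING #23) until paid; HC_CM is proved only modulo the 7 printed citations (2 remaining: hLiu418 =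
stmt-HodgeConjecture-24832, h413 = stmt-HodgeConjecture-24833) until rung 0 closes; calculus bookkeeping, pays nothing by itself.

## References
* [Bouaziz1994IntegralesOrbitales] A. Bouaziz, *Intégrales orbitales sur les groupes de Lie réductifs*, Ann. Sci. ÉNS (4) 27 (1994), §2.3 Lemme 2.3.1; §5.1 p. 588.
* [Varadarajan1989] V. S. Varadarajan, *An Introduction to Harmonic Analysis on Semisimple Lie Groups* (1989), §6 p. 229.
* [HormanderALPDO1] L. Hörmander, *The Analysis of Linear Partial Differential Operators I* (1983), §1.4 Thm. 1.4.1 (cutoffs), §1.1.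
-/

set_option autoImplicit false

noncomputable section

open Complex Set Function Real Filter Topology Metric
open scoped ContDiff
open Literature.NumberTheory.Automorphic.ArchCartan
open Literature.Analysis.Calculus

namespace Literature.NumberTheory.Rogawski1990

/-! ## §1 Two calculus lemmas: smooth cutoffs equal to one on a closed ball; `χ · g` is smooth when `g` is smooth near `tsupport χ` -/

section Calculus

variable {E : Type*} [NormedAddCommGroup E] [NormedSpace ℝ E]

/-- **A PRODUCT WITH A SMOOTH CUTOFF IS SMOOTH** once the other factor is `C^∞` on an open set containing the cutoff's topological support (off `tsupport χ` the product vanishes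
identically near each point). [cite: HormanderALPDO1, §1.1; §1.4 Thm. 1.4.1] -/
theorem contDiff_ofReal_mul_of_tsupport_subset {χ : E → ℝ} {g : E → ℂ} {U : Set E} (hU : IsOpen U) (hχ : ContDiff ℝ ∞ χ) (hsupp : tsupport χ ⊆ U)
    (hg : ContDiffOn ℝ ∞ g U) : ContDiff ℝ ∞ (fun y => ((χ y : ℝ) : ℂ) * g y) := by
  refine contDiff_iff_contDiffAt.2 fun y => ?_
  by_cases hy : y ∈ U
  · exact ((Complex.ofRealCLM.contDiff.comp hχ).contDiffAt).mul (hg.contDiffAt (hU.mem_nhds hy))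
  · have hy' : y ∉ tsupport χ := fun h => hy (hsupp h)
    have h0 : (fun y => ((χ y : ℝ) : ℂ) * g y) =ᶠ[𝓝 y] fun _ => 0 := by
      filter_upwards [notMem_tsupport_iff_eventuallyEq.1 hy'] with z hz
      rw [hz, Pi.zero_apply, Complex.ofReal_zero, zero_mul]
    exact (contDiffAt_const (c := (0 : ℂ))).congr_of_eventuallyEq h0

/-- **A SMOOTH CUTOFF EQUAL TO ONE ON A CLOSED BALL, SUPPORTED IN THE DOUBLED OPEN BALL** (finite dimension): ★ `exists_fin_contDiff_tsupport_subset_ball_sum_eq_one` on the compact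
closed ball with constant radii, summed. [cite: HormanderALPDO1, §1.4 Thm. 1.4.1] [cite: Bouaziz1994IntegralesOrbitales, §2.3 Lemme 2.3.1] -/
theorem exists_contDiff_eq_one_closedBall_tsupport_subset [FiniteDimensional ℝ E] (b₀ : E) {ε : ℝ} (hε : 0 < ε) :
    ∃ χ : E → ℝ, ContDiff ℝ ∞ χ ∧ (∀ y ∈ closedBall b₀ ε, χ y = 1) ∧ tsupport χ ⊆ ball b₀ (2 * ε) := by
  obtain ⟨n, b, F, hF, hsum⟩ := exists_fin_contDiff_tsupport_subset_ball_sum_eq_one (isCompact_closedBall b₀ ε) (fun _ => ε) (fun _ => hε)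
  refine ⟨fun y => ∑ i, F i y, ContDiff.sum fun i _ => (hF i).2.1, fun y hy => hsum y hy, ?_⟩
  -- the topological support of the sum lies in the (closed, finite) union of the supports, each inside `ball (b i) ε ⊆ ball b₀ (2ε)`
  have hT : IsClosed (⋃ i, tsupport (F i)) := isClosed_iUnion_of_finite fun i => isClosed_tsupport _
  have hsub : Function.support (fun y => ∑ i, F i y) ⊆ ⋃ i, tsupport (F i) := by
    intro y hy
    obtain ⟨i, -, hi⟩ := Finset.exists_ne_zero_of_sum_ne_zero hy
    exact mem_iUnion.2 ⟨i, subset_tsupport _ hi⟩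
  refine (closure_minimal hsub hT).trans (iUnion_subset fun i => (hF i).2.2.2.1.trans ?_)
  intro y hy
  rw [mem_ball] at hy ⊢
  have hb : dist (b i) b₀ ≤ ε := mem_closedBall.1 (hF i).1
  calc dist y b₀ ≤ dist y (b i) + dist (b i) b₀ := dist_triangle _ _ _
    _ < ε + ε := add_lt_add_of_lt_of_le hy hb
    _ = 2 * ε := by ring

end Calculus

/-! ## §2 The assembly of (Σ4c) from (sec) + (desc) -/

section Descent

variable {W : Type*} [Fintype W] [DecidableEq W]

/-- **(Σ4c) DESCENT THROUGH THE CLASS MAP, MODULO (sec) + (desc).**  `S` a chart, `c₀ ∈ RegS S`, `Φ` a (P)(W)(X)-covariant family member smooth on `InRegS S` and non-zero at the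
regular points whose class is `ε₀`-close to `b₀ = bzClassMap S c₀`.  ASSUME (sec): a `C^∞` local section `σ` of `bzClassMap S` on an open `U ∋ b₀` with `σ b₀ = c₀`; and (desc): for
every (P)(W)(X)-covariant `Ψ`, equal classes of regular points give `Φ c′ ≠ 0 ∧ Ψ c ∕ Φ c = Ψ c′ ∕ Φ c′`.  THEN there is `ε ∈ (0, ε₀]` such that every such `Ψ` smooth on `InRegS S`
DESCENDS: `∃ F ∈ C^∞(W → ℂ × ℂ × ℂ)`, `F (bzClassMap S c) · Φ c = Ψ c` for all `c ∈ RegS S` with `dist (bzClassMap S c) b₀ < ε` (p04's interface text, `ε` BEFORE `Ψ`).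
[cite: Bouaziz1994IntegralesOrbitales, §5.1 p. 588] [cite: Varadarajan1989, §6 p. 229] -/
theorem exists_classDescent_of_section_of_descent (S : Finset W) {c₀ : W → Fin 3 → ℝ} (hc₀ : c₀ ∈ RegS S) (Φ : (W → Fin 3 → ℝ) → ℂ) {ε₀ : ℝ} (hε₀ : 0 < ε₀)
    (hΦs : ContDiffOn ℝ ∞ Φ (InRegS S)) (hΦ0 : ∀ c ∈ RegS S, dist (bzClassMap S c) (bzClassMap S c₀) < ε₀ → Φ c ≠ 0)
    (hsec : ∃ U : Set (W → ℂ × ℂ × ℂ), IsOpen U ∧ bzClassMap S c₀ ∈ U ∧ ∃ σ : (W → ℂ × ℂ × ℂ) → (W → Fin 3 → ℝ), ContDiffOn ℝ ∞ σ U ∧ σ (bzClassMap S c₀) = c₀ ∧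
      ∀ c : W → Fin 3 → ℝ, bzClassMap S c ∈ U → bzClassMap S (σ (bzClassMap S c)) = bzClassMap S c)
    (hdesc : ∀ Ψ : (W → Fin 3 → ℝ) → ℂ, (∀ (c : W → Fin 3 → ℝ) (w : W) (i : Fin 3) (k : ℤ), (w ∉ S ∨ i ≠ 0) → Ψ (c + angleShift w i k) = Ψ c) →
      (∀ (c : W → Fin 3 → ℝ) (w : W), w ∉ S → Ψ (flipAt w c) * archRH S c = archRH S (flipAt w c) * Ψ c) →
      (∀ (c : W → Fin 3 → ℝ) (w : W), w ∈ S → Ψ (negXAt w c) = Ψ c) →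
      ∀ {c c' : W → Fin 3 → ℝ}, c ∈ RegS S → c' ∈ RegS S → bzClassMap S c = bzClassMap S c' → Φ c ≠ 0 → Φ c' ≠ 0 ∧ Ψ c / Φ c = Ψ c' / Φ c') :
    ∃ ε : ℝ, 0 < ε ∧ ε ≤ ε₀ ∧ ∀ Ψ : (W → Fin 3 → ℝ) → ℂ,
      (∀ (c : W → Fin 3 → ℝ) (w : W) (i : Fin 3) (k : ℤ), (w ∉ S ∨ i ≠ 0) → Ψ (c + angleShift w i k) = Ψ c) →
      (∀ (c : W → Fin 3 → ℝ) (w : W), w ∉ S → Ψ (flipAt w c) * archRH S c = archRH S (flipAt w c) * Ψ c) →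
      (∀ (c : W → Fin 3 → ℝ) (w : W), w ∈ S → Ψ (negXAt w c) = Ψ c) →
      ContDiffOn ℝ ∞ Ψ (InRegS S) →
        ∃ F : (W → ℂ × ℂ × ℂ) → ℂ, ContDiff ℝ ∞ F ∧ ∀ c ∈ RegS S, dist (bzClassMap S c) (bzClassMap S c₀) < ε → F (bzClassMap S c) * Φ c = Ψ c := by
  obtain ⟨U, hU, hb₀, σ, hσ, hσ₀, hσsec⟩ := hsec
  have hσc : ContinuousOn σ U := hσ.continuousOn
  -- shrink `U`: `σ` lands in `RegS S` and `bzClassMap S ∘ σ` in the `ε₀`-ball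
  have hU₁ : IsOpen (U ∩ σ ⁻¹' RegS S) := hσc.isOpen_inter_preimage hU (isOpen_regS S)
  have hκc : ContinuousOn (fun y => bzClassMap S (σ y)) (U ∩ σ ⁻¹' RegS S) :=
    (continuous_bzClassMap S).comp_continuousOn (hσc.mono inter_subset_left)
  have hU' : IsOpen ((U ∩ σ ⁻¹' RegS S) ∩ (fun y => bzClassMap S (σ y)) ⁻¹' ball (bzClassMap S c₀) ε₀) := hκc.isOpen_inter_preimage hU₁ isOpen_ball
  have hb₀' : bzClassMap S c₀ ∈ (U ∩ σ ⁻¹' RegS S) ∩ (fun y => bzClassMap S (σ y)) ⁻¹' ball (bzClassMap S c₀) ε₀ := by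
    refine ⟨⟨hb₀, ?_⟩, ?_⟩
    · rw [mem_preimage, hσ₀]; exact hc₀
    · rw [mem_preimage, hσ₀]; exact mem_ball_self hε₀
  obtain ⟨r, hr, hball⟩ := Metric.isOpen_iff.1 hU' _ hb₀'
  -- the radius and the cutoff
  set ε : ℝ := min (r / 3) ε₀ with hεdef
  have hε : 0 < ε := lt_min (by positivity) hε₀
  have hεr : 2 * ε < r := by
    have : ε ≤ r / 3 := min_le_left _ _
    linarith
  obtain ⟨χ, hχ, hχ1, hχsupp⟩ := exists_contDiff_eq_one_closedBall_tsupport_subset (bzClassMap S c₀) hε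
  have hsuppU : tsupport χ ⊆ (U ∩ σ ⁻¹' RegS S) ∩ (fun y => bzClassMap S (σ y)) ⁻¹' ball (bzClassMap S c₀) ε₀ :=
    hχsupp.trans ((ball_subset_ball hεr.le).trans hball)
  refine ⟨ε, hε, min_le_right _ _, fun Ψ hΨP hΨW hΨX hΨs => ?_⟩
  -- the descended function
  have hmaps : MapsTo σ ((U ∩ σ ⁻¹' RegS S) ∩ (fun y => bzClassMap S (σ y)) ⁻¹' ball (bzClassMap S c₀) ε₀) (InRegS S) :=
    fun y hy => regS_subset_inRegS S hy.1.2
  have hσ' : ContDiffOn ℝ ∞ σ ((U ∩ σ ⁻¹' RegS S) ∩ (fun y => bzClassMap S (σ y)) ⁻¹' ball (bzClassMap S c₀) ε₀) :=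
    hσ.mono (inter_subset_left.trans inter_subset_left)
  have hΨσ : ContDiffOn ℝ ∞ (fun y => Ψ (σ y)) ((U ∩ σ ⁻¹' RegS S) ∩ (fun y => bzClassMap S (σ y)) ⁻¹' ball (bzClassMap S c₀) ε₀) := hΨs.comp hσ' hmaps
  have hΦσ : ContDiffOn ℝ ∞ (fun y => Φ (σ y)) ((U ∩ σ ⁻¹' RegS S) ∩ (fun y => bzClassMap S (σ y)) ⁻¹' ball (bzClassMap S c₀) ε₀) := hΦs.comp hσ' hmaps
  have hΦσ0 : ∀ y ∈ (U ∩ σ ⁻¹' RegS S) ∩ (fun y => bzClassMap S (σ y)) ⁻¹' ball (bzClassMap S c₀) ε₀, Φ (σ y) ≠ 0 :=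
    fun y hy => hΦ0 (σ y) hy.1.2 (mem_ball.1 hy.2)
  have hg : ContDiffOn ℝ ∞ (fun y => Ψ (σ y) * (Φ (σ y))⁻¹) ((U ∩ σ ⁻¹' RegS S) ∩ (fun y => bzClassMap S (σ y)) ⁻¹' ball (bzClassMap S c₀) ε₀) :=
    hΨσ.mul (hΦσ.inv hΦσ0)
  refine ⟨fun y => ((χ y : ℝ) : ℂ) * (Ψ (σ y) * (Φ (σ y))⁻¹), contDiff_ofReal_mul_of_tsupport_subset hU' hχ hsuppU hg, fun c hc hdist => ?_⟩
  -- the identity at a regular point whose class is `ε`-close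
  have hy : bzClassMap S c ∈ (U ∩ σ ⁻¹' RegS S) ∩ (fun y => bzClassMap S (σ y)) ⁻¹' ball (bzClassMap S c₀) ε₀ :=
    hball (mem_ball.2 (hdist.trans (by linarith)))
  have hc' : σ (bzClassMap S c) ∈ RegS S := hy.1.2
  have hcls : bzClassMap S c = bzClassMap S (σ (bzClassMap S c)) := (hσsec c hy.1.1).symm
  have hΦc : Φ c ≠ 0 := hΦ0 c hc (hdist.trans_le (min_le_right _ _))
  obtain ⟨hΦc', hq⟩ := hdesc Ψ hΨP hΨW hΨX hc hc' hcls hΦc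
  have h1 : χ (bzClassMap S c) = 1 := hχ1 _ (mem_closedBall.2 hdist.le)
  show ((χ (bzClassMap S c) : ℝ) : ℂ) * (Ψ (σ (bzClassMap S c)) * (Φ (σ (bzClassMap S c)))⁻¹) * Φ c = Ψ c
  rw [h1, Complex.ofReal_one, one_mul, ← div_eq_mul_inv, ← hq, div_mul_cancel₀ _ hΦc]

end Descent

end Literature.NumberTheory.Rogawski1990

end
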